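import Summits.QuantumFields.YangMills.Theorems.LangevinControlUVOSLegsFromFemtoAndGapStubAssemblyMomentWeights
import Summits.QuantumFields.YangMills.Theorems.LangevinControlUVOSLegsFromFemtoAndGapStubAssemblyUniformBoundPrep
import HarnessLib

/-!
# Soft OS-assembly toolkit VIII-a: strings of observables, exact lattice symmetries, translation defect

Helper file for stub `stub_assembly`/`stub_assembly6` of crux `OSLegsFromFemtoAndGap` (stmt-QuantumFields-9367,
line `dlr-collar-transfer`).  The soft OS legs are statements about limits of the lattice distributions
`F ↦ Σₓ W(x) F(a x)`; after the lead's reshape r2 the weights `W` are centred torus moments of STRINGS of local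
observables (one observable per insertion, e.g. single-plane plaquette fields), so this file sets up the
string versions `torusMomentStr`/`latticeDistStr` of toolkit III's `torusMoment`/`latticeDist` (which are their
constant-string special cases, `rfl`) and proves the exact lattice facts the inheritance step consumes:

* `torusMomentStr_add_const` — invariance of the weights under a common lattice translation of all sites
  (translation invariance of Wilson's measure on the torus);
* `torusMomentStr_comp_perm`, `latticeDistStr_permTest` — symmetry under simultaneous permutation of
  observables, normalisations, and sites (E3 on the lattice, exactly);
* `norm_latticeDistStr_translate_sub_le` — the only defect of translation invariance of `latticeDistStr` is the
  wrap zone: for lattice vectors `v` with `2‖v‖ ≤ L`, spacing `a ≤ 1` and `L ≥ a⁻²`,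
  `‖T(F(· − a v)) − T(F)‖ ≤ 2·3⁴ⁿ·2^{8n+1}·Mⁿ·‖F‖_{8n+1,0} · a` given the sup bound `|W| ≤ Mⁿ`.
-/

noncomputable section

open scoped SchwartzMap BigOperators
open MeasureTheory Filter Topology
open Literature.MathematicalPhysics.QuantumFieldTheory Literature.MathematicalPhysics.QuantumLattice
open Literature.MathematicalPhysics.AQFT
open Literature.Probability.LatticeModels (box Site mem_box)

namespace Summit.QuantumFields.YangMills.Theorems.OSLegsFromFemtoAndGap

local notation "E4" => EuclideanSpace ℝ (Fin 4)

variable {G : Type} [Group G] [TopologicalSpace G] [IsTopologicalGroup G] [CompactSpace G]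
  [MeasurableSpace G] [BorelSpace G]

/-! ### Strings of observables -/

/-- **Centred torus moment of a string of observables** `W(x) = ∫ ∏ᵢ (Oᵢ(τ_{xᵢ} Ũ) − mᵢ) dμ_{β,2L+1}(U)`
(one observable and one additive normalisation per insertion). -/
def torusMomentStr {N : ℕ} (ρ : G →* Matrix (Fin N) (Fin N) ℂ) (β : ℝ) (L : ℕ) {n : ℕ}
    (O : Fin n → LGConfig 4 G → ℝ) (m : Fin n → ℝ) (x : Fin n → Site 4) : ℝ :=
  ∫ U, ∏ i, (O i (configShift (-(x i)) (torusLift (2 * L + 1) U)) - m i)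
    ∂(wilsonMeasure (d := 4) (L := 2 * L + 1) ρ β)

/-- **The lattice `n`-point distribution of a string of observables** at spacing `a` on the torus of half-side
`L`: `F ↦ Σ_{x ∈ (box L)ⁿ} W(x) F(a x)`. -/
def latticeDistStr {N : ℕ} (ρ : G →* Matrix (Fin N) (Fin N) ℂ) (β : ℝ) (L : ℕ) (a : ℝ) {n : ℕ}
    (O : Fin n → LGConfig 4 G → ℝ) (m : Fin n → ℝ) : 𝓢((Fin n → E4), ℂ) →L[ℂ] ℂ :=
  ∑ x ∈ Fintype.piFinset (fun _ : Fin n => box 4 L),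
    ((torusMomentStr ρ β L O m x : ℝ) : ℂ) • LabelledSchwingerFamily.evalAt (fun i => a • siteToE (x i))

/-- Toolkit III's `torusMoment` is the constant-string case. -/
theorem torusMoment_eq_torusMomentStr {N : ℕ} (ρ : G →* Matrix (Fin N) (Fin N) ℂ) (β : ℝ) (L : ℕ)
    (O : LGConfig 4 G → ℝ) (m : ℝ) {n : ℕ} (x : Fin n → Site 4) :
    torusMoment ρ β L O m x = torusMomentStr ρ β L (fun _ => O) (fun _ => m) x :=
  rfl

/-- Toolkit III's `latticeDist` is the constant-string case. -/
theorem latticeDist_eq_latticeDistStr {N : ℕ} (ρ : G →* Matrix (Fin N) (Fin N) ℂ) (β : ℝ) (L : ℕ)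
    (a : ℝ) (O : LGConfig 4 G → ℝ) (m : ℝ) (n : ℕ) :
    latticeDist ρ β L a O m n = latticeDistStr ρ β L a (fun _ : Fin n => O) (fun _ => m) :=
  rfl

/-- Unfolding `latticeDistStr`: `latticeDistStr … F = ∑ₓ W(x) F(a x)`. -/
theorem latticeDistStr_apply {N : ℕ} (ρ : G →* Matrix (Fin N) (Fin N) ℂ) (β : ℝ) (L : ℕ) (a : ℝ)
    {n : ℕ} (O : Fin n → LGConfig 4 G → ℝ) (m : Fin n → ℝ) (F : 𝓢((Fin n → E4), ℂ)) :
    latticeDistStr ρ β L a O m F =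
      ∑ x ∈ Fintype.piFinset (fun _ : Fin n => box 4 L),
        ((torusMomentStr ρ β L O m x : ℝ) : ℂ) * F (fun i => a • siteToE (x i)) := by
  simp only [latticeDistStr, FunLike.coe_sum, Finset.sum_apply,
    FunLike.coe_smul, Pi.smul_apply, LabelledSchwingerFamily.evalAt_apply, smul_eq_mul]

/-! ### Exact lattice symmetries of the weights -/

omit [TopologicalSpace G] [IsTopologicalGroup G] [CompactSpace G] [BorelSpace G] [Group G] in
/-- Composition of lattice translations: `τ_{u+v} = τ_u ∘ τ_v`. -/
theorem configShift_neg_add (u v : Site 4) (V : LGConfig 4 G) :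
    configShift (-(u + v)) V = configShift (-u) (configShift (-v) V) := by
  funext e
  simp only [configShift_apply, sub_neg_eq_add, add_assoc]

/-- **Translation invariance of the weights**: shifting all sites by the same lattice vector does not change
the centred torus moment (translation invariance of Wilson's measure on the torus). -/
theorem torusMomentStr_add_const {N : ℕ} (ρ : G →* Matrix (Fin N) (Fin N) ℂ) (β : ℝ) (L : ℕ) {n : ℕ}
    (O : Fin n → LGConfig 4 G → ℝ) (m : Fin n → ℝ) (x : Fin n → Site 4) (v : Site 4) :
    torusMomentStr ρ β L O m (fun i => x i + v) = torusMomentStr ρ β L O m x := by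
  haveI : NeZero (2 * L + 1) := ⟨by omega⟩
  unfold torusMomentStr
  have h : (fun U : GaugeConfig 4 (2 * L + 1) G =>
        ∏ i, (O i (configShift (-(x i + v)) (torusLift (2 * L + 1) U)) - m i)) =
      toTorusObservable (2 * L + 1)
        ((fun V : LGConfig 4 G => ∏ i, (O i (configShift (-(x i)) V) - m i)) ∘ configShift (-v)) := by
    funext U
    simp only [toTorusObservable, Function.comp_apply, configShift_neg_add]
  have h' : (fun U : GaugeConfig 4 (2 * L + 1) G =>
        ∏ i, (O i (configShift (-(x i)) (torusLift (2 * L + 1) U)) - m i)) =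
      toTorusObservable (2 * L + 1) (fun V : LGConfig 4 G => ∏ i, (O i (configShift (-(x i)) V) - m i)) := by
    funext U
    simp only [toTorusObservable, Function.comp_apply]
  rw [h, h', toTorusObservable_comp_configShift]
  exact wilsonExpectation_comp_torusConfigShift (ρ := ρ) β _ _

/-- **Permutation symmetry of the weights**: permuting observables, normalisations and sites simultaneously
does not change the moment (the factors commute). -/
theorem torusMomentStr_comp_perm {N : ℕ} (ρ : G →* Matrix (Fin N) (Fin N) ℂ) (β : ℝ) (L : ℕ) {n : ℕ}
    (O : Fin n → LGConfig 4 G → ℝ) (m : Fin n → ℝ) (x : Fin n → Site 4) (σ : Equiv.Perm (Fin n)) :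
    torusMomentStr ρ β L (O ∘ σ) (m ∘ σ) (x ∘ σ) = torusMomentStr ρ β L O m x := by
  unfold torusMomentStr
  congr 1
  funext U
  exact Fintype.prod_equiv σ _ _ fun i => rfl

/-- **E3 on the lattice, exactly**: `latticeDistStr O m (permTest σ F) = latticeDistStr (O ∘ σ) (m ∘ σ) F` — the
observable string travels with its argument, as in `LabelledSchwingerFamily.IsSymmetric`. -/
theorem latticeDistStr_permTest {N : ℕ} (ρ : G →* Matrix (Fin N) (Fin N) ℂ) (β : ℝ) (L : ℕ) (a : ℝ)
    {n : ℕ} (O : Fin n → LGConfig 4 G → ℝ) (m : Fin n → ℝ) (σ : Equiv.Perm (Fin n))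
    (F : 𝓢((Fin n → E4), ℂ)) :
    latticeDistStr ρ β L a O m (permTest σ F) = latticeDistStr ρ β L a (O ∘ σ) (m ∘ σ) F := by
  rw [latticeDistStr_apply, latticeDistStr_apply]
  -- reindex the sum over multi-sites by `x ↦ x ∘ σ`
  refine Finset.sum_bij' (fun x _ => x ∘ σ) (fun x _ => x ∘ σ.symm) (fun x hx => ?_)
    (fun x hx => ?_) (fun x _ => ?_) (fun x _ => ?_) (fun x _ => ?_)
  · simp only [Fintype.mem_piFinset, Function.comp_apply] at hx ⊢
    exact fun i => hx _
  · simp only [Fintype.mem_piFinset, Function.comp_apply] at hx ⊢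
    exact fun i => hx _
  · funext i; simp
  · funext i; simp
  · rw [torusMomentStr_comp_perm, permTest_apply]
    rfl

/-! ### The translation defect of the lattice distributions (wrap zone only) -/

/-- Schwartz decay at a multi-point one of whose components is far: `‖F y‖ ≤ ‖F‖_{k,0} / t^k` if `t ≤ ‖yᵢ‖`. -/
theorem norm_apply_le_seminorm_div {n : ℕ} (F : 𝓢((Fin n → E4), ℂ)) (k : ℕ) {y : Fin n → E4} {t : ℝ}
    (ht : 0 < t) (i : Fin n) (hy : t ≤ ‖y i‖) :
    ‖F y‖ ≤ SchwartzMap.seminorm ℂ k 0 F / t ^ k := by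
  have h1 : t ≤ ‖y‖ := hy.trans (norm_le_pi_norm y i)
  have h2 := SchwartzMap.norm_pow_mul_le_seminorm ℂ F k y
  rw [le_div_iff₀ (pow_pos ht k)]
  calc ‖F y‖ * t ^ k ≤ ‖F y‖ * ‖y‖ ^ k := by gcongr
    _ = ‖y‖ ^ k * ‖F y‖ := mul_comm _ _
    _ ≤ _ := h2

/-- A multi-site outside `(box L)ⁿ` has a component of sup norm `> L`. -/
theorem exists_lt_norm_of_not_mem_piFinset_box {n L : ℕ} {y : Fin n → Site 4}
    (hy : y ∉ Fintype.piFinset (fun _ : Fin n => box 4 L)) : ∃ i, (L : ℝ) < ‖y i‖ := by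
  simp only [Fintype.mem_piFinset, not_forall] at hy
  obtain ⟨i, hi⟩ := hy
  rw [mem_box, not_forall] at hi
  obtain ⟨k, hk⟩ := hi
  refine ⟨i, ?_⟩
  have hk' : (L : ℝ) < |(y i k : ℝ)| := by
    rcases not_and_or.1 hk with h | h
    · push Not at h
      have : ((y i k : ℤ) : ℝ) < -(L : ℝ) := by exact_mod_cast h
      have habs : -((y i k : ℤ) : ℝ) ≤ |((y i k : ℤ) : ℝ)| := neg_le_abs _
      linarith
    · push Not at h
      have : (L : ℝ) < ((y i k : ℤ) : ℝ) := by exact_mod_cast h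
      exact this.trans_le (le_abs_self _)
  have h2 : (‖y i k‖ : ℝ) ≤ ‖y i‖ := norm_le_pi_norm (y i) k
  rw [Int.norm_eq_abs] at h2
  linarith

/-- **The translation defect.**  Given the sup bound `|W| ≤ Mⁿ` on the weights, translating the test function by
a lattice vector `a v` with `2‖v‖ ≤ L` changes `latticeDistStr … F` only through the wrap zone: for `0 < a ≤ 1` and
`L ≥ a⁻²`, `‖T(F(· − a v)) − T(F)‖ ≤ 2·3⁴ⁿ·2^{8n+1}·Mⁿ·‖F‖_{8n+1,0}·a`. -/
theorem norm_latticeDistStr_translate_sub_le {N : ℕ} (ρ : G →* Matrix (Fin N) (Fin N) ℂ) (β : ℝ) (L : ℕ)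
    {n : ℕ} (O : Fin n → LGConfig 4 G → ℝ) (m : Fin n → ℝ) {M : ℝ} (hM : 0 ≤ M)
    (hW : ∀ x : Fin n → Site 4, |torusMomentStr ρ β L O m x| ≤ M ^ n) {a : ℝ} (ha : 0 < a) (ha1 : a ≤ 1)
    (hLa : a⁻¹ * a⁻¹ ≤ L) (v : Site 4) (hv : 2 * ‖v‖ ≤ (L : ℝ)) (F : 𝓢((Fin n → E4), ℂ)) :
    ‖latticeDistStr ρ β L a O m (translateMulti (a • siteToE v) F) - latticeDistStr ρ β L a O m F‖ ≤
      2 * 3 ^ (4 * n) * 2 ^ (8 * n + 1) * M ^ n * SchwartzMap.seminorm ℂ (8 * n + 1) 0 F * a := by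
  classical
  -- the two index sets and the summand
  set S₁ : Finset (Fin n → Site 4) := Fintype.piFinset (fun _ : Fin n => box 4 L) with hS₁
  set vv : Fin n → Site 4 := fun _ => v with hvv
  set e : (Fin n → Site 4) ≃ (Fin n → Site 4) := Equiv.subRight vv with he
  set S₂ : Finset (Fin n → Site 4) := S₁.map e.toEmbedding with hS₂
  set g : (Fin n → Site 4) → ℂ := fun y =>
    ((torusMomentStr ρ β L O m y : ℝ) : ℂ) * F (fun i => a • siteToE (y i)) with hg
  -- Step 1: the translated distribution is the same sum over the shifted index set
  have h1 : latticeDistStr ρ β L a O m (translateMulti (a • siteToE v) F) = ∑ y ∈ S₂, g y := by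
    rw [latticeDistStr_apply, Finset.sum_map]
    refine Finset.sum_congr rfl fun x _ => ?_
    have hx : e x = fun i => x i + -v := by
      funext i; simp [he, hvv, sub_eq_add_neg]
    simp only [hg, Equiv.coe_toEmbedding, hx, translateMulti_apply, torusMomentStr_add_const]
    congr 2
    funext i
    rw [← sub_eq_add_neg, siteToE_sub, smul_sub]
  have h2 : latticeDistStr ρ β L a O m F = ∑ y ∈ S₁, g y := latticeDistStr_apply ρ β L a O m F
  rw [h1, h2, ← Finset.sum_sdiff_sub_sum_sdiff]
  -- Step 2: sizes
  have hainv : (1 : ℝ) ≤ a⁻¹ := one_le_inv_iff₀.2 ⟨ha, ha1⟩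
  have hL1 : (1 : ℝ) ≤ L := le_trans (by nlinarith) hLa
  have haaL : (1 : ℝ) ≤ a * a * L := by
    have := mul_le_mul_of_nonneg_left hLa (show (0 : ℝ) ≤ a * a by positivity)
    rwa [show a * a * (a⁻¹ * a⁻¹) = 1 by field_simp] at this
  set t : ℝ := a * L / 2 with ht
  have htpos : 0 < t := by positivity
  set B : ℝ := M ^ n * (SchwartzMap.seminorm ℂ (8 * n + 1) 0 F / t ^ (8 * n + 1)) with hB
  have hB0 : 0 ≤ B := by positivity
  -- Step 3: per-term bound in the wrap zone
  have hterm : ∀ y : Fin n → Site 4, (∃ i, (L : ℝ) < 2 * ‖y i‖) → ‖g y‖ ≤ B := by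
    rintro y ⟨i, hi⟩
    rw [hg]; dsimp only
    rw [norm_mul, Complex.norm_real, Real.norm_eq_abs, hB]
    refine mul_le_mul (hW y) ?_ (norm_nonneg _) (pow_nonneg hM n)
    refine norm_apply_le_seminorm_div F (8 * n + 1) htpos i ?_
    have := mul_norm_le_norm_smul_siteToE ha.le (y i)
    have : t ≤ a * ‖y i‖ := by rw [ht]; nlinarith
    linarith
  have hA : ∀ y ∈ S₂ \ S₁, ∃ i, (L : ℝ) < 2 * ‖y i‖ := by
    intro y hy
    rw [Finset.mem_sdiff] at hy
    obtain ⟨i, hi⟩ := exists_lt_norm_of_not_mem_piFinset_box hy.2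
    exact ⟨i, by linarith [norm_nonneg (y i)]⟩
  have hBset : ∀ y ∈ S₁ \ S₂, ∃ i, (L : ℝ) < 2 * ‖y i‖ := by
    intro y hy
    rw [Finset.mem_sdiff] at hy
    have hy2 : y + vv ∉ S₁ := by
      intro h
      apply hy.2
      rw [hS₂, Finset.mem_map_equiv]
      have : e.symm y = y + vv := by funext i; simp [he]
      rwa [this]
    obtain ⟨i, hi⟩ := exists_lt_norm_of_not_mem_piFinset_box hy2
    refine ⟨i, ?_⟩
    have h3 : ‖(y + vv) i‖ ≤ ‖y i‖ + ‖v‖ := by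
      simpa [hvv] using norm_add_le (y i) v
    linarith
  -- Step 4: sum the bounds
  have hcard₁ : (S₁.card : ℝ) = ((2 * L + 1 : ℕ) : ℝ) ^ (4 * n) := by
    rw [hS₁, Fintype.card_piFinset, Finset.prod_const, Finset.card_univ, Fintype.card_fin,
      Literature.Probability.LatticeModels.card_box, ← pow_mul]
    push_cast
    ring
  have hcard₂ : (S₂.card : ℝ) = ((2 * L + 1 : ℕ) : ℝ) ^ (4 * n) := by
    rw [hS₂, Finset.card_map, hcard₁]
  have hsum₁ : ‖∑ y ∈ S₂ \ S₁, g y‖ ≤ ((2 * L + 1 : ℕ) : ℝ) ^ (4 * n) * B := by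
    calc ‖∑ y ∈ S₂ \ S₁, g y‖ ≤ ∑ y ∈ S₂ \ S₁, ‖g y‖ := norm_sum_le _ _
      _ ≤ ∑ _y ∈ S₂ \ S₁, B := Finset.sum_le_sum fun y hy => hterm y (hA y hy)
      _ = ((S₂ \ S₁).card : ℝ) * B := by rw [Finset.sum_const, nsmul_eq_mul]
      _ ≤ (S₂.card : ℝ) * B := by gcongr; exact Finset.sdiff_subset
      _ = _ := by rw [hcard₂]
  have hsum₂ : ‖∑ y ∈ S₁ \ S₂, g y‖ ≤ ((2 * L + 1 : ℕ) : ℝ) ^ (4 * n) * B := by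
    calc ‖∑ y ∈ S₁ \ S₂, g y‖ ≤ ∑ y ∈ S₁ \ S₂, ‖g y‖ := norm_sum_le _ _
      _ ≤ ∑ _y ∈ S₁ \ S₂, B := Finset.sum_le_sum fun y hy => hterm y (hBset y hy)
      _ = ((S₁ \ S₂).card : ℝ) * B := by rw [Finset.sum_const, nsmul_eq_mul]
      _ ≤ (S₁.card : ℝ) * B := by gcongr; exact Finset.sdiff_subset
      _ = _ := by rw [hcard₁]
  -- Step 5: the arithmetic `(2L+1)^{4n} / t^{8n+1} ≤ 3^{4n} 2^{8n+1} a`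
  have key : ((2 * L + 1 : ℕ) : ℝ) ^ (4 * n) ≤ 3 ^ (4 * n) * a * (a * L) ^ (8 * n + 1) := by
    have h3 : ((2 * L + 1 : ℕ) : ℝ) ≤ 3 * L := by push_cast; linarith
    calc ((2 * L + 1 : ℕ) : ℝ) ^ (4 * n) ≤ (3 * (L : ℝ)) ^ (4 * n) := pow_le_pow_left₀ (by positivity) h3 _
      _ = 3 ^ (4 * n) * (L : ℝ) ^ (4 * n) := mul_pow _ _ _
      _ ≤ 3 ^ (4 * n) * (L : ℝ) ^ (4 * n) * (a * a * L) ^ (4 * n + 1) :=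
          le_mul_of_one_le_right (by positivity) (one_le_pow₀ haaL)
      _ = 3 ^ (4 * n) * a * (a * L) ^ (8 * n + 1) := by ring
  have hfinal : 2 * ((2 * L + 1 : ℕ) : ℝ) ^ (4 * n) * B ≤
      2 * 3 ^ (4 * n) * 2 ^ (8 * n + 1) * M ^ n * SchwartzMap.seminorm ℂ (8 * n + 1) 0 F * a := by
    have htpow : t ^ (8 * n + 1) = (a * L) ^ (8 * n + 1) / 2 ^ (8 * n + 1) := by
      rw [ht, div_pow]
    have haL : 0 < (a * L) ^ (8 * n + 1) := by positivity
    rw [hB, htpow, div_div_eq_mul_div]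
    rw [show 2 * ((2 * L + 1 : ℕ) : ℝ) ^ (4 * n) *
        (M ^ n * (SchwartzMap.seminorm ℂ (8 * n + 1) 0 F * 2 ^ (8 * n + 1) / (a * L) ^ (8 * n + 1))) =
        2 * M ^ n * SchwartzMap.seminorm ℂ (8 * n + 1) 0 F * 2 ^ (8 * n + 1) *
          (((2 * L + 1 : ℕ) : ℝ) ^ (4 * n) / (a * L) ^ (8 * n + 1)) by ring]
    have hq : ((2 * L + 1 : ℕ) : ℝ) ^ (4 * n) / (a * L) ^ (8 * n + 1) ≤ 3 ^ (4 * n) * a := by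
      rw [div_le_iff₀ haL]; linarith [key]
    calc 2 * M ^ n * SchwartzMap.seminorm ℂ (8 * n + 1) 0 F * 2 ^ (8 * n + 1) *
          (((2 * L + 1 : ℕ) : ℝ) ^ (4 * n) / (a * L) ^ (8 * n + 1))
        ≤ 2 * M ^ n * SchwartzMap.seminorm ℂ (8 * n + 1) 0 F * 2 ^ (8 * n + 1) * (3 ^ (4 * n) * a) := by
          gcongr
      _ = _ := by ring
  calc ‖∑ y ∈ S₂ \ S₁, g y - ∑ y ∈ S₁ \ S₂, g y‖
      ≤ ‖∑ y ∈ S₂ \ S₁, g y‖ + ‖∑ y ∈ S₁ \ S₂, g y‖ := norm_sub_le _ _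
    _ ≤ ((2 * L + 1 : ℕ) : ℝ) ^ (4 * n) * B + ((2 * L + 1 : ℕ) : ℝ) ^ (4 * n) * B := add_le_add hsum₁ hsum₂
    _ = 2 * ((2 * L + 1 : ℕ) : ℝ) ^ (4 * n) * B := by ring
    _ ≤ _ := hfinal

end Summit.QuantumFields.YangMills.Theorems.OSLegsFromFemtoAndGap

end
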